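import Summits.BirchSwinnertonDyer.BirchSwinnertonDyer.Theorems.ByReductionTypeAtTwoMultUpperHalfTower
import Summits.BirchSwinnertonDyer.BirchSwinnertonDyer.Theorems.ByReductionTypeAtTwoTowerFiltrationClasses
import Literature.NumberTheory.EllipticCurves.IsogenyIdProofs
import HarnessLib

/-!
# Route `ByReductionTypeAtTwo`, item `MultUpperHalfAtTwo` (stmt-BirchSwinnertonDyer-19922): the multiplicative TOWER
# road in the EXACT «A-currency» — `MissingUpperBoundAt W 2` / `BSDp W 2` at a rank-0, `E[2]`-irreducible,
# multiplicative-at-2 curve from ONE window of the `(σ−1)`-filtration of the RELAXED layer group `A_n[2]`, with NO local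
# interface and NO local constant (seat bsd-2adic-tower-1 GEN 13; home item stmt-BirchSwinnertonDyer-19271)

HONEST FRAMING (cell `bsd-2adic`, run/shared/lean/pub/bsd-2adic/, HUMAN RULINGS D-0036/D-0054/D-0074): door THEOREMS only;
no definition, no new named fact, no `sorry`; they close no item by themselves; nothing is booked; BSD is not proved by any
of this. PARTITION: X5@2 multiplicative TOWER rows (K4ᵐ, item 19922; the `E[2]`-irreducible block) × p = 2 —
types-the-object-of (the W-level composition generator lanes instantiate in five lines per member); closes none.

WHAT. GEN 13's gap doors `TowerFiltration.towerGapAtTwo_of_filtration_classCounts{,_upper}` (file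
`…TowerFiltrationClasses`, p571615: `O1.TowerGapAtTwo W` from two filtered counts at ONE layer, the upper one — or both —
read off `A_n[2] = h_n⁻¹(Sel_{2^∞}(E/ℚ_∞))[2]`, EXACT by mult-2's `natCard_quotient_towerIdeal_eq_natCard_layerFiltration`;
no `S`, `C_v`, `N_v`, `h0`, `hC`) composed with the mult lane's class door
`missingUpperBoundAt_two_mult_of_towerGapMember'` (`…MultUpperHalfTower`, mult-3/mult-2): for `W/ℚ` globally minimal,
analytic rank `0`, multiplicative at `2`, `Irr W 2` (so the torsion order is odd and the period datum is PRINT — Česnavičius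
+ odd isogenies):
* `MultTowerAcur.missingUpperBoundAt_two_of_filtration_classCounts_upper` — HYBRID certificate (lower count = the classical
  σ-piece `2^a ≤ #{z ∈ Sel_{2^∞}(E/ℚ_n)[2] : ν^[m] z = 0}`, upper count = the induced σ-piece
  `#{z ∈ A_n[2] : ν^[m+k] z = 0} ≤ 2^d`, `d + 1 ≤ k + a`) ⟹ `MissingUpperBoundAt W 2`; `…bsdp_two_…` adds the descent
  inequality `hsha : MissingLowerBoundAt W 2` ⟹ `BSDp W 2`;
* `MultTowerAcur.missingUpperBoundAt_two_of_filtration_classCounts` / `bsdp_two_…` — both counts induced;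
* `…_member` forms — the certificate carried by an isogenous `E[2]`-irreducible member `W₁ ~_ℚ W`.
DISPLAYED, NOT PROVED: PRINT {`h41ns'` guarded Thm-4.1 analogue, `h41sp` A236, `hmod`, `hGZK`, `hCassels`, Česnavičius `hC`} +
MEMO {`hKato` K11a (RC-2), `hGS` (RC-4, idle at a non-split 2)} — VERBATIM the binders of every mult tower class file of record —
+ CERTIFICATES {`hr`, the two σ-piece counts, `had`, (`hsha`)}. GONE from the display: the odd-prime set `P`, `hΔ`, the local
constants `C`/`e`/`hC` and every local lever (`_addv*`, NS2/SP1 bits) — the A-currency count absorbs them EXACTLY. The induced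
count at the place over `2` is fed by an engine reading the `ℚ_∞`-induced local condition at a MULTIPLICATIVE `2`
(`tower/NOTE-B1-MULT-GEN13.md`: `e₀`-component in `⟨2 + y_n⟩` split / `⟨−3, 2 + y_n⟩` non-split) — evidence tier, as the classical `d_j`.

References: R. Greenberg, LNM 1716 (1999) §1 p. 60, §2 pp. 74–76, §3 pp. 85–94, §4 pp. 112–113; K. Česnavičius, Duke
Math. J. 167 (2018) Thm. 1.2; R. L. Miller, LMS J. Comput. Math. 14 (2011) Def. 1.1; the docstrings of the two imported files.
-/

set_option autoImplicit false
-- the Theorems namespace of this sub repeats the summit name by design (D-0017 nested layout: Summit.<S>.<Sub>)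
set_option linter.dupNamespace false

noncomputable section

open scoped Classical MatrixGroups ModularForm

open NumberField IsDedekindDomain CongruenceSubgroup WeierstrassCurve Literature.NumberTheory.EllipticCurves
  Literature.NumberTheory.EllipticCurves.ModularForms Literature.NumberTheory.EllipticCurves.Rank1Residual
  Literature.NumberTheory.EllipticCurves.Rank1Residual.Typed
  Literature.NumberTheory.EllipticCurves.Greenberg1999
  Summit.BirchSwinnertonDyer.Rank1Residual.X5 Summit.BirchSwinnertonDyer.Rank1Residual.X5.O1
  Summit.BirchSwinnertonDyer.BirchSwinnertonDyer.Theorems.KatoHalfPinch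
  Summit.BirchSwinnertonDyer.BirchSwinnertonDyer.Theorems.Rank1ResidualX1Defs

namespace Summit.BirchSwinnertonDyer.BirchSwinnertonDyer.Theorems.MultTowerAcur

section Curve

variable (W : WeierstrassCurve ℚ) [W.IsElliptic] [W.IsGloballyMinimal]

/-- **The A-currency σ-window gap at an `E[2]`-irreducible curve, HYBRID counts** (odd torsion from `Irr W 2`,
`not_two_dvd_torsionOrder_of_irr_two`): `m + k ≤ 2ⁿ`, `2^a ≤ #{z ∈ Sel_{2^∞}(E/ℚ_n)[2] : ν^[m] z = 0}`,
`#{z ∈ A_n[2] : ν^[m+k] z = 0} ≤ 2^d`, `d + 1 ≤ k + a` ⟹ `O1.TowerGapAtTwo W`.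
[cite: GreenbergLNM1716, §1 p. 60 and §3 pp. 85–86] [cite: Washington1997, §13.2] -/
theorem towerGapAtTwo_of_filtration_classCounts_upper_of_irr (hirr : Irr W 2) {n m k a d : ℕ}
    (hmk : m + k ≤ 2 ^ n)
    (hlow : ∀ (κ : ZpExtension ℚ 2) (γ : Field.absoluteGaloisGroup ℚ), κ.IsCyclotomic →
      κ.IsTopGenerator γ →
        2 ^ a ≤ Nat.card {z : W.selmerLayer κ n // 2 • z = 0 ∧
          (⇑(W.conjH1 2 (κ.layerSubgroup n) γ -
            AddMonoidHom.id (W.subgroupH1 2 (κ.layerSubgroup n))))^[m]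
            (z : W.subgroupH1 2 (κ.layerSubgroup n)) = 0})
    (hup : ∀ (κ : ZpExtension ℚ 2) (γ : Field.absoluteGaloisGroup ℚ), κ.IsCyclotomic →
      κ.IsTopGenerator γ →
        Nat.card {z : W.selmerInftyPreimage κ n // 2 • z = 0 ∧
          (⇑(W.conjH1 2 (κ.layerSubgroup n) γ -
            AddMonoidHom.id (W.subgroupH1 2 (κ.layerSubgroup n))))^[m + k]
            (z : W.subgroupH1 2 (κ.layerSubgroup n)) = 0} ≤ 2 ^ d)
    (had : d + 1 ≤ k + a) : TowerGapAtTwo W :=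
  TowerFiltration.towerGapAtTwo_of_filtration_classCounts_upper W (not_two_dvd_torsionOrder_of_irr_two W hirr)
    hmk hlow hup (by omega)

/-- **The A-currency σ-window gap at an `E[2]`-irreducible curve, BOTH counts induced**: `m + k ≤ 2ⁿ`,
`2^a ≤ #{z ∈ A_n[2] : ν^[m] z = 0}`, `#{z ∈ A_n[2] : ν^[m+k] z = 0} ≤ 2^d`, `d + 1 ≤ k + a` ⟹ `O1.TowerGapAtTwo W`.
[cite: GreenbergLNM1716, §1 p. 60 and §3 pp. 85–86] [cite: Washington1997, §13.2] -/
theorem towerGapAtTwo_of_filtration_classCounts_of_irr (hirr : Irr W 2) {n m k a d : ℕ}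
    (hmk : m + k ≤ 2 ^ n)
    (hlow : ∀ (κ : ZpExtension ℚ 2) (γ : Field.absoluteGaloisGroup ℚ), κ.IsCyclotomic →
      κ.IsTopGenerator γ →
        2 ^ a ≤ Nat.card {z : W.selmerInftyPreimage κ n // 2 • z = 0 ∧
          (⇑(W.conjH1 2 (κ.layerSubgroup n) γ -
            AddMonoidHom.id (W.subgroupH1 2 (κ.layerSubgroup n))))^[m]
            (z : W.subgroupH1 2 (κ.layerSubgroup n)) = 0})
    (hup : ∀ (κ : ZpExtension ℚ 2) (γ : Field.absoluteGaloisGroup ℚ), κ.IsCyclotomic →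
      κ.IsTopGenerator γ →
        Nat.card {z : W.selmerInftyPreimage κ n // 2 • z = 0 ∧
          (⇑(W.conjH1 2 (κ.layerSubgroup n) γ -
            AddMonoidHom.id (W.subgroupH1 2 (κ.layerSubgroup n))))^[m + k]
            (z : W.subgroupH1 2 (κ.layerSubgroup n)) = 0} ≤ 2 ^ d)
    (had : d + 1 ≤ k + a) : TowerGapAtTwo W :=
  TowerFiltration.towerGapAtTwo_of_filtration_classCounts W (not_two_dvd_torsionOrder_of_irr_two W hirr)
    hmk hlow hup (by omega)

/-- **UPPER HALF at a rank-0, multiplicative-at-2, `E[2]`-irreducible `W` from ONE A-currency σ-window, HYBRID counts.**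
PRINT {`h41ns'`, `h41sp`, `hmod`, `hGZK`, `hCassels`, `hC`} + MEMO {`hKato` (RC-2), `hGS` (RC-4)} + CERTIFICATES {`hr`,
`hlow` (classical σ-piece), `hup` (induced σ-piece), `had : d + 1 ≤ k + a`}; NO odd-prime data, NO local constant.
[cite: GreenbergLNM1716, §3 pp. 85–94 and §4 pp. 112–113] [cite: Cesnavicius2018, Thm. 1.2] [cite: Miller2011LMS, Def. 1.1] -/
theorem missingUpperBoundAt_two_of_filtration_classCounts_upper
    (hKato : ∀ (W : WeierstrassCurve ℚ) [W.IsElliptic] [W.IsGloballyMinimal],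
      ¬ W.HasCM → Mult W 2 → O1.KatoMultiplicativeDivisibilityRat W 2)
    (h41ns' : thm41Analogue_charValue_rankZero_numberField_anyPrime_oddLocalDegree)
    (h41sp : thm41Analogue_charValue_rankZero_split_baseChange_anyPrime)
    (hmod : nonempty_modularParametrizationData)
    (hGZK : rank_eq_analyticRank_of_analyticRank_le_one)
    (hCassels : bsdRHS_eq_of_isIsogenous)
    (hC : cesnavicius_not_two_dvd_maninConstant_of_two_dvd_level)
    (hGS : ∀ (W : WeierstrassCurve ℚ) [W.IsElliptic] [W.IsGloballyMinimal],
      W.HasSplitMultiplicativeReductionAtPrime 2 → greenberg_stevens (W := W) (p := 2))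
    (hr : W.analyticRank = 0) (hmult : Mult W 2) (hirr : Irr W 2) {n m k a d : ℕ} (hmk : m + k ≤ 2 ^ n)
    (hlow : ∀ (κ : ZpExtension ℚ 2) (γ : Field.absoluteGaloisGroup ℚ), κ.IsCyclotomic →
      κ.IsTopGenerator γ →
        2 ^ a ≤ Nat.card {z : W.selmerLayer κ n // 2 • z = 0 ∧
          (⇑(W.conjH1 2 (κ.layerSubgroup n) γ -
            AddMonoidHom.id (W.subgroupH1 2 (κ.layerSubgroup n))))^[m]
            (z : W.subgroupH1 2 (κ.layerSubgroup n)) = 0})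
    (hup : ∀ (κ : ZpExtension ℚ 2) (γ : Field.absoluteGaloisGroup ℚ), κ.IsCyclotomic →
      κ.IsTopGenerator γ →
        Nat.card {z : W.selmerInftyPreimage κ n // 2 • z = 0 ∧
          (⇑(W.conjH1 2 (κ.layerSubgroup n) γ -
            AddMonoidHom.id (W.subgroupH1 2 (κ.layerSubgroup n))))^[m + k]
            (z : W.subgroupH1 2 (κ.layerSubgroup n)) = 0} ≤ 2 ^ d)
    (had : d + 1 ≤ k + a) : MissingUpperBoundAt W 2 :=
  missingUpperBoundAt_two_mult_of_towerGapMember' hKato h41ns' h41sp hmod hGZK hCassels hC hGS W hr hmult W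
    (IsIsogenous.refl_holds W) (towerGapAtTwo_of_filtration_classCounts_upper_of_irr W hirr hmk hlow hup had)
    (Or.inl hirr)

/-- **`BSDp W 2` at a rank-0, multiplicative-at-2, `E[2]`-irreducible `W` from ONE A-currency σ-window (HYBRID counts) + the
descent inequality `hsha : MissingLowerBoundAt W 2`.** [cite: Miller2011LMS, Def. 1.1] [cite: GreenbergLNM1716, §3 pp. 85–94] -/
theorem bsdp_two_of_filtration_classCounts_upper
    (hKato : ∀ (W : WeierstrassCurve ℚ) [W.IsElliptic] [W.IsGloballyMinimal],
      ¬ W.HasCM → Mult W 2 → O1.KatoMultiplicativeDivisibilityRat W 2)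
    (h41ns' : thm41Analogue_charValue_rankZero_numberField_anyPrime_oddLocalDegree)
    (h41sp : thm41Analogue_charValue_rankZero_split_baseChange_anyPrime)
    (hmod : nonempty_modularParametrizationData)
    (hGZK : rank_eq_analyticRank_of_analyticRank_le_one)
    (hCassels : bsdRHS_eq_of_isIsogenous)
    (hC : cesnavicius_not_two_dvd_maninConstant_of_two_dvd_level)
    (hGS : ∀ (W : WeierstrassCurve ℚ) [W.IsElliptic] [W.IsGloballyMinimal],
      W.HasSplitMultiplicativeReductionAtPrime 2 → greenberg_stevens (W := W) (p := 2))
    (hr : W.analyticRank = 0) (hmult : Mult W 2) (hirr : Irr W 2) {n m k a d : ℕ} (hmk : m + k ≤ 2 ^ n)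
    (hlow : ∀ (κ : ZpExtension ℚ 2) (γ : Field.absoluteGaloisGroup ℚ), κ.IsCyclotomic →
      κ.IsTopGenerator γ →
        2 ^ a ≤ Nat.card {z : W.selmerLayer κ n // 2 • z = 0 ∧
          (⇑(W.conjH1 2 (κ.layerSubgroup n) γ -
            AddMonoidHom.id (W.subgroupH1 2 (κ.layerSubgroup n))))^[m]
            (z : W.subgroupH1 2 (κ.layerSubgroup n)) = 0})
    (hup : ∀ (κ : ZpExtension ℚ 2) (γ : Field.absoluteGaloisGroup ℚ), κ.IsCyclotomic →
      κ.IsTopGenerator γ →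
        Nat.card {z : W.selmerInftyPreimage κ n // 2 • z = 0 ∧
          (⇑(W.conjH1 2 (κ.layerSubgroup n) γ -
            AddMonoidHom.id (W.subgroupH1 2 (κ.layerSubgroup n))))^[m + k]
            (z : W.subgroupH1 2 (κ.layerSubgroup n)) = 0} ≤ 2 ^ d)
    (had : d + 1 ≤ k + a) (hsha : MissingLowerBoundAt W 2) : BSDp W 2 :=
  bsdp_of_missingPPartAt W 2 hGZK (hr.le.trans zero_le_one)
    (missingPPartAt_of_lower_of_upper W 2 hsha
      (missingUpperBoundAt_two_of_filtration_classCounts_upper W hKato h41ns' h41sp hmod hGZK hCassels hC hGS hr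
        hmult hirr hmk hlow hup had))

/-- **UPPER HALF, both counts induced** (`2^a ≤ #{z ∈ A_n[2] : ν^[m] z = 0}`, `#{z ∈ A_n[2] : ν^[m+k] z = 0} ≤ 2^d`,
`d + 1 ≤ k + a`). Same PRINT/MEMO display. [cite: GreenbergLNM1716, §3 pp. 85–94 and §4 pp. 112–113]
[cite: Cesnavicius2018, Thm. 1.2] [cite: Miller2011LMS, Def. 1.1] -/
theorem missingUpperBoundAt_two_of_filtration_classCounts
    (hKato : ∀ (W : WeierstrassCurve ℚ) [W.IsElliptic] [W.IsGloballyMinimal],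
      ¬ W.HasCM → Mult W 2 → O1.KatoMultiplicativeDivisibilityRat W 2)
    (h41ns' : thm41Analogue_charValue_rankZero_numberField_anyPrime_oddLocalDegree)
    (h41sp : thm41Analogue_charValue_rankZero_split_baseChange_anyPrime)
    (hmod : nonempty_modularParametrizationData)
    (hGZK : rank_eq_analyticRank_of_analyticRank_le_one)
    (hCassels : bsdRHS_eq_of_isIsogenous)
    (hC : cesnavicius_not_two_dvd_maninConstant_of_two_dvd_level)
    (hGS : ∀ (W : WeierstrassCurve ℚ) [W.IsElliptic] [W.IsGloballyMinimal],
      W.HasSplitMultiplicativeReductionAtPrime 2 → greenberg_stevens (W := W) (p := 2))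
    (hr : W.analyticRank = 0) (hmult : Mult W 2) (hirr : Irr W 2) {n m k a d : ℕ} (hmk : m + k ≤ 2 ^ n)
    (hlow : ∀ (κ : ZpExtension ℚ 2) (γ : Field.absoluteGaloisGroup ℚ), κ.IsCyclotomic →
      κ.IsTopGenerator γ →
        2 ^ a ≤ Nat.card {z : W.selmerInftyPreimage κ n // 2 • z = 0 ∧
          (⇑(W.conjH1 2 (κ.layerSubgroup n) γ -
            AddMonoidHom.id (W.subgroupH1 2 (κ.layerSubgroup n))))^[m]
            (z : W.subgroupH1 2 (κ.layerSubgroup n)) = 0})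
    (hup : ∀ (κ : ZpExtension ℚ 2) (γ : Field.absoluteGaloisGroup ℚ), κ.IsCyclotomic →
      κ.IsTopGenerator γ →
        Nat.card {z : W.selmerInftyPreimage κ n // 2 • z = 0 ∧
          (⇑(W.conjH1 2 (κ.layerSubgroup n) γ -
            AddMonoidHom.id (W.subgroupH1 2 (κ.layerSubgroup n))))^[m + k]
            (z : W.subgroupH1 2 (κ.layerSubgroup n)) = 0} ≤ 2 ^ d)
    (had : d + 1 ≤ k + a) : MissingUpperBoundAt W 2 :=
  missingUpperBoundAt_two_mult_of_towerGapMember' hKato h41ns' h41sp hmod hGZK hCassels hC hGS W hr hmult W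
    (IsIsogenous.refl_holds W) (towerGapAtTwo_of_filtration_classCounts_of_irr W hirr hmk hlow hup had)
    (Or.inl hirr)

end Curve

/-! ## §2 The class form: the certificate carried by an isogenous `E[2]`-irreducible member -/

section Member

/-- **UPPER HALF at every member `W` of the class of a certified member `W₁`** (`W₁ ~_ℚ W`, `Irr W₁ 2`, one A-currency
σ-window at `W₁`, HYBRID counts). Same display; Cassels moves the half across the class inside
`missingUpperBoundAt_two_mult_of_towerGapMember'`. [cite: GreenbergLNM1716, §3 pp. 85–94 and §4 pp. 112–113]
[cite: Cesnavicius2018, Thm. 1.2] [cite: Cassels1965ArithmeticVIII] [cite: Miller2011LMS, Def. 1.1] -/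
theorem missingUpperBoundAt_two_of_filtration_classCounts_upper_member
    (hKato : ∀ (W : WeierstrassCurve ℚ) [W.IsElliptic] [W.IsGloballyMinimal],
      ¬ W.HasCM → Mult W 2 → O1.KatoMultiplicativeDivisibilityRat W 2)
    (h41ns' : thm41Analogue_charValue_rankZero_numberField_anyPrime_oddLocalDegree)
    (h41sp : thm41Analogue_charValue_rankZero_split_baseChange_anyPrime)
    (hmod : nonempty_modularParametrizationData)
    (hGZK : rank_eq_analyticRank_of_analyticRank_le_one)
    (hCassels : bsdRHS_eq_of_isIsogenous)
    (hC : cesnavicius_not_two_dvd_maninConstant_of_two_dvd_level)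
    (hGS : ∀ (W : WeierstrassCurve ℚ) [W.IsElliptic] [W.IsGloballyMinimal],
      W.HasSplitMultiplicativeReductionAtPrime 2 → greenberg_stevens (W := W) (p := 2))
    (W : WeierstrassCurve ℚ) [W.IsElliptic] [W.IsGloballyMinimal] (hr : W.analyticRank = 0) (hmult : Mult W 2)
    (W₁ : WeierstrassCurve ℚ) [W₁.IsElliptic] [W₁.IsGloballyMinimal] (hiso : IsIsogenous W W₁) (hirr₁ : Irr W₁ 2)
    {n m k a d : ℕ} (hmk : m + k ≤ 2 ^ n)
    (hlow : ∀ (κ : ZpExtension ℚ 2) (γ : Field.absoluteGaloisGroup ℚ), κ.IsCyclotomic →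
      κ.IsTopGenerator γ →
        2 ^ a ≤ Nat.card {z : W₁.selmerLayer κ n // 2 • z = 0 ∧
          (⇑(W₁.conjH1 2 (κ.layerSubgroup n) γ -
            AddMonoidHom.id (W₁.subgroupH1 2 (κ.layerSubgroup n))))^[m]
            (z : W₁.subgroupH1 2 (κ.layerSubgroup n)) = 0})
    (hup : ∀ (κ : ZpExtension ℚ 2) (γ : Field.absoluteGaloisGroup ℚ), κ.IsCyclotomic →
      κ.IsTopGenerator γ →
        Nat.card {z : W₁.selmerInftyPreimage κ n // 2 • z = 0 ∧
          (⇑(W₁.conjH1 2 (κ.layerSubgroup n) γ -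
            AddMonoidHom.id (W₁.subgroupH1 2 (κ.layerSubgroup n))))^[m + k]
            (z : W₁.subgroupH1 2 (κ.layerSubgroup n)) = 0} ≤ 2 ^ d)
    (had : d + 1 ≤ k + a) : MissingUpperBoundAt W 2 :=
  missingUpperBoundAt_two_mult_of_towerGapMember' hKato h41ns' h41sp hmod hGZK hCassels hC hGS W hr hmult W₁ hiso
    (towerGapAtTwo_of_filtration_classCounts_upper_of_irr W₁ hirr₁ hmk hlow hup had) (Or.inl hirr₁)

/-- **`BSDp W 2` at every member of the class of a certified member `W₁`** (HYBRID counts at `W₁`) + `hsha : MissingLowerBoundAt W 2`.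
[cite: Miller2011LMS, Def. 1.1] [cite: Cassels1965ArithmeticVIII] -/
theorem bsdp_two_of_filtration_classCounts_upper_member
    (hKato : ∀ (W : WeierstrassCurve ℚ) [W.IsElliptic] [W.IsGloballyMinimal],
      ¬ W.HasCM → Mult W 2 → O1.KatoMultiplicativeDivisibilityRat W 2)
    (h41ns' : thm41Analogue_charValue_rankZero_numberField_anyPrime_oddLocalDegree)
    (h41sp : thm41Analogue_charValue_rankZero_split_baseChange_anyPrime)
    (hmod : nonempty_modularParametrizationData)
    (hGZK : rank_eq_analyticRank_of_analyticRank_le_one)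
    (hCassels : bsdRHS_eq_of_isIsogenous)
    (hC : cesnavicius_not_two_dvd_maninConstant_of_two_dvd_level)
    (hGS : ∀ (W : WeierstrassCurve ℚ) [W.IsElliptic] [W.IsGloballyMinimal],
      W.HasSplitMultiplicativeReductionAtPrime 2 → greenberg_stevens (W := W) (p := 2))
    (W : WeierstrassCurve ℚ) [W.IsElliptic] [W.IsGloballyMinimal] (hr : W.analyticRank = 0) (hmult : Mult W 2)
    (W₁ : WeierstrassCurve ℚ) [W₁.IsElliptic] [W₁.IsGloballyMinimal] (hiso : IsIsogenous W W₁) (hirr₁ : Irr W₁ 2)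
    {n m k a d : ℕ} (hmk : m + k ≤ 2 ^ n)
    (hlow : ∀ (κ : ZpExtension ℚ 2) (γ : Field.absoluteGaloisGroup ℚ), κ.IsCyclotomic →
      κ.IsTopGenerator γ →
        2 ^ a ≤ Nat.card {z : W₁.selmerLayer κ n // 2 • z = 0 ∧
          (⇑(W₁.conjH1 2 (κ.layerSubgroup n) γ -
            AddMonoidHom.id (W₁.subgroupH1 2 (κ.layerSubgroup n))))^[m]
            (z : W₁.subgroupH1 2 (κ.layerSubgroup n)) = 0})
    (hup : ∀ (κ : ZpExtension ℚ 2) (γ : Field.absoluteGaloisGroup ℚ), κ.IsCyclotomic →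
      κ.IsTopGenerator γ →
        Nat.card {z : W₁.selmerInftyPreimage κ n // 2 • z = 0 ∧
          (⇑(W₁.conjH1 2 (κ.layerSubgroup n) γ -
            AddMonoidHom.id (W₁.subgroupH1 2 (κ.layerSubgroup n))))^[m + k]
            (z : W₁.subgroupH1 2 (κ.layerSubgroup n)) = 0} ≤ 2 ^ d)
    (had : d + 1 ≤ k + a) (hsha : MissingLowerBoundAt W 2) : BSDp W 2 :=
  bsdp_of_missingPPartAt W 2 hGZK (hr.le.trans zero_le_one)
    (missingPPartAt_of_lower_of_upper W 2 hsha
      (missingUpperBoundAt_two_of_filtration_classCounts_upper_member hKato h41ns' h41sp hmod hGZK hCassels hC hGS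
        W hr hmult W₁ hiso hirr₁ hmk hlow hup had))

end Member

end Summit.BirchSwinnertonDyer.BirchSwinnertonDyer.Theorems.MultTowerAcur

end
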